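import Summits.CriticalPhenomena.PercolationContinuityZ3.Theorems.PercNearOneGluingNoHeavyLowerTailSunflowerSpectatorTransferOrPetalPair
import HarnessLib

/-!
# `NoHeavyLowerTail` (crux stmt-CriticalPhenomena-4575), abstract sunflower cubic: BLOCK CODES on a general support `S₀` for the
# spectator-transfer inequality (♣) behind a disjunctive petal — placement decomposition and the finite state tables

Support file (seat `prim-ineq-gen-2` gen 23; `--supports stmt-CriticalPhenomena-4575`).  No `sorry`, no named facts; nothing is asserted about
the crux.  First of four files proving `SpectatorTransfer` (`2·Nabk 3 ≤ SA + SB + 2·Nkk 3`, tree `…SunflowerSpectatorTransfer`) behind a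
disjunctive petal `IsOrPetal S₀` for EVERY nonempty `S₀` (the cases `|S₀| = 2, 3` are `…SpectatorTransferOrPetalPair/Triple`, by `decide` on
8³ / 22³ block codes; here `|S₀|` is arbitrary).  Memo: run/shared/lean/prim/prim-ineq-gen-2/gen23/CLUB-ORPETAL-ALL-R.md.

THE REDUCTION (as in the pair file).  After the trace split along `S₀` (`sum_parts_eq_sum_traces`, `sum_parts_trace_eq`) the quantity
`Q = SA + SB + 2·Nkk 3 − 2·Nabk 3` is a sum over the ordered 3-partitions `(X,Y,Z)` of `E = S₀ᶜ` of a PLACEMENT SUM over the ordered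
3-partitions `(σ₁,σ₂,σ₃)` of `S₀` of `clubKer (lab (X ∪ σ₁)) (lab (Y ∪ σ₂)) (lab (Z ∪ σ₃))`; it depends on the blocks only through their BLOCK
CODES `g_X = (σ ↦ lab (X ∪ σ))`, which are admissible (`IsCode`: free label `g ∅ ≠ 3`, lifted labels in `{3,4}`, diamond monotonicity).
Subtracting the antipodal-Gladkov rows of the first blocks with weight `rowT` (marked, or bottom with `S₀` the only kernel trace) and
symmetrising over the three blocks leaves the POINTWISE claim `2·codeRows ≤ codeSum` for every admissible code triple
(`…SunflowerOrPetalSectors`), assembled in `…SunflowerSpectatorTransferOrPetal`.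

HERE: `propers S₀` (proper nonempty subsets) and the HIT-PATTERN DECOMPOSITION `sum_partsOf_decomp` of a sum over `partsOf S₀` (three
one-block placements, the two-block placements indexed by a proper subset, the three-block placements as an iterated sum); the complement
involution `sum_propers_sdiff`; codes, `rowT`, `codeSum`, `codeRows`, the grouped pieces `oneSum` / `pairSum σ` (the SIX two-block placements
of the complementary pair `{σ, S₀∖σ}`) / `threeSum` and the identity `2·(codeSum − 2·codeRows) = 2·oneSum + Σ_σ pairSum σ + 2·threeSum`;
the finite STATE TABLES — one-block states `Fin 6` = (free label, label of `S₀`, row weight), pair states `Fin 7` = (free label, label of `σ`,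
label of `S₀∖σ`) — with every kernel fact used later proved by `decide` (≤ 343 cases each): `oneOf ≥ −2` and negative only for two marked
blocks plus a bottom block with a proper kernel trace; `pairOf ≥ 0` with a marked block, `≥ 4` when it pays that deficit, and in the bottom
sector `pairOf ≥ −12` exactly on the uniformly oriented pairs (cut parity of a 6-cycle); `club6 ≥ 0` on lifted labels, `≥ 4` with two petal labels.
-/

namespace Summit.CriticalPhenomena.PercolationContinuityZ3.Theorems.SunflowerPartition

open Finset

variable {α : Type*} [DecidableEq α]

/-! ## Proper nonempty subsets and the hit-pattern decomposition of `partsOf S₀` -/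

/-- The proper nonempty subsets of `S₀`. [this work] -/
def propers (S₀ : Finset α) : Finset (Finset α) := (S₀.powerset.erase ∅).erase S₀

/-- Membership in `propers`. [this work] -/
theorem mem_propers {S₀ σ : Finset α} : σ ∈ propers S₀ ↔ σ ⊆ S₀ ∧ σ ≠ ∅ ∧ σ ≠ S₀ := by
  unfold propers
  rw [mem_erase, mem_erase, mem_powerset]
  tauto

/-- A sum over the power set splits off `∅`, `S₀` and the proper nonempty subsets (`S₀ ≠ ∅`). [this work] -/
theorem sum_powerset_eq_propers {S₀ : Finset α} (h₀ : S₀.Nonempty) (f : Finset α → ℤ) :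
    ∑ X ∈ S₀.powerset, f X = f ∅ + f S₀ + ∑ X ∈ propers S₀, f X := by
  have h1 : (∅ : Finset α) ∈ S₀.powerset := mem_powerset.2 (empty_subset _)
  have h2 : S₀ ∈ S₀.powerset.erase ∅ := mem_erase.2 ⟨h₀.ne_empty, mem_powerset.2 subset_rfl⟩
  unfold propers
  rw [← sum_erase_add _ _ h1, ← sum_erase_add _ _ h2]
  ring

/-- The complement of a proper nonempty subset is a proper nonempty subset. [this work] -/
theorem sdiff_mem_propers {S₀ σ : Finset α} (h : σ ∈ propers S₀) : S₀ \ σ ∈ propers S₀ := by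
  rw [mem_propers] at h ⊢
  obtain ⟨h1, h2, h3⟩ := h
  refine ⟨sdiff_subset, ?_, ?_⟩
  · intro he
    apply h3
    exact Subset.antisymm h1 (sdiff_eq_empty_iff_subset.1 he)
  · intro he
    apply h2
    have : σ ∩ S₀ = ∅ := by
      have hd : Disjoint σ (S₀ \ σ) := disjoint_sdiff
      rw [he] at hd
      exact disjoint_iff_inter_eq_empty.1 hd
    rwa [inter_eq_left.2 h1] at this

/-- The complement involution on `propers S₀`. [this work] -/
theorem sum_propers_sdiff (S₀ : Finset α) (f : Finset α → ℤ) :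
    ∑ σ ∈ propers S₀, f (S₀ \ σ) = ∑ σ ∈ propers S₀, f σ := by
  refine sum_nbij' (fun σ => S₀ \ σ) (fun σ => S₀ \ σ) ?_ ?_ ?_ ?_ ?_
  · intro σ hσ; exact sdiff_mem_propers hσ
  · intro σ hσ; exact sdiff_mem_propers hσ
  · intro σ hσ; exact Finset.sdiff_sdiff_eq_self (mem_propers.1 hσ).1
  · intro σ hσ; exact Finset.sdiff_sdiff_eq_self (mem_propers.1 hσ).1
  · intro σ _; rfl

/-- **Hit-pattern decomposition** of a sum over the ordered 3-partitions of a nonempty `S₀`: the three one-block placements,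
the two-block placements indexed by the proper subset in the lower-numbered pattern position, and the three-block placements
as an iterated sum. [this work] -/
theorem sum_partsOf_decomp {S₀ : Finset α} (h₀ : S₀.Nonempty) (f : Finset α → Finset α → Finset α → ℤ) :
    ∑ s ∈ partsOf S₀, f s.1 s.2 (S₀ \ (s.1 ∪ s.2))
      = (f S₀ ∅ ∅ + f ∅ S₀ ∅ + f ∅ ∅ S₀)
        + ∑ σ ∈ propers S₀, (f σ (S₀ \ σ) ∅ + f σ ∅ (S₀ \ σ) + f ∅ σ (S₀ \ σ))
        + ∑ X ∈ propers S₀, ∑ Y ∈ propers (S₀ \ X), f X Y (S₀ \ (X ∪ Y)) := by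
  rw [sum_partsOf_eq_sum_powerset S₀ (fun X Y => f X Y (S₀ \ (X ∪ Y))), sum_powerset_eq_propers h₀]
  have eS : ∑ Y ∈ (S₀ \ S₀).powerset, f S₀ Y (S₀ \ (S₀ ∪ Y)) = f S₀ ∅ ∅ := by
    rw [sdiff_self, bot_eq_empty, powerset_empty, sum_singleton, union_empty, sdiff_self, bot_eq_empty]
  have e0 : ∑ Y ∈ (S₀ \ ∅).powerset, f ∅ Y (S₀ \ (∅ ∪ Y))
      = f ∅ S₀ ∅ + f ∅ ∅ S₀ + ∑ σ ∈ propers S₀, f ∅ σ (S₀ \ σ) := by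
    rw [sdiff_empty, sum_powerset_eq_propers h₀]
    simp only [empty_union, sdiff_self, bot_eq_empty, sdiff_empty]
    ring
  have eP : ∀ X ∈ propers S₀, ∑ Y ∈ (S₀ \ X).powerset, f X Y (S₀ \ (X ∪ Y))
      = f X (S₀ \ X) ∅ + f X ∅ (S₀ \ X) + ∑ Y ∈ propers (S₀ \ X), f X Y (S₀ \ (X ∪ Y)) := by
    intro X hX
    have hX' := mem_propers.1 hX
    have hne : (S₀ \ X).Nonempty := by
      rw [nonempty_iff_ne_empty]
      exact (mem_propers.1 (sdiff_mem_propers hX)).2.1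
    rw [sum_powerset_eq_propers hne]
    rw [union_empty, union_sdiff_of_subset hX'.1, sdiff_self, bot_eq_empty]
    ring
  rw [eS, e0, sum_congr rfl eP, sum_add_distrib, sum_add_distrib, sum_add_distrib, sum_add_distrib]
  ring

/-! ## The symmetrised club kernel and block codes -/

/-- The fully symmetrised kernel of `Q = SA + SB + 2·Nkk 3 − 2·Nabk 3` (`symm6Of clubKer`). [this work] -/
def club6 (x y z : Fin 5) : ℤ := symm6Of clubKer x y z

/-- A BLOCK CODE on the support `S₀`: the labels `g σ = lab (X ∪ σ)`, `σ ⊆ S₀`, of a block `X` disjoint from `S₀` behind a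
disjunctive petal with support `S₀` — free label `g ∅ ≠ 3`, lifted labels in `{3,4}`, diamond monotonicity. [this work] -/
def IsCode (S₀ : Finset α) (g : Finset α → Fin 5) : Prop :=
  g ∅ ≠ 3 ∧ (∀ σ, σ ⊆ S₀ → σ.Nonempty → g σ = 3 ∨ g σ = 4) ∧ (∀ σ τ, σ ⊆ τ → τ ⊆ S₀ → g σ = g τ ∨ g σ = 0 ∨ g τ = 4)

namespace IsCode

variable {S₀ : Finset α} {g : Finset α → Fin 5} (h : IsCode S₀ g)
include h

omit [DecidableEq α] in
/-- The free label is not the disjunctive petal. [this work] -/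
theorem free : g ∅ ≠ 3 := h.1

omit [DecidableEq α] in
/-- Nonempty traces lift into `{3,4}`. [this work] -/
theorem lift {σ : Finset α} (hσ : σ ⊆ S₀) (hne : σ.Nonempty) : g σ = 3 ∨ g σ = 4 := h.2.1 σ hσ hne

omit [DecidableEq α] in
/-- Monotonicity in the diamond order. [this work] -/
theorem mono {σ τ : Finset α} (hστ : σ ⊆ τ) (hτ : τ ⊆ S₀) : g σ = g τ ∨ g σ = 0 ∨ g τ = 4 := h.2.2 σ τ hστ hτ

omit [DecidableEq α] in
/-- A marked block (`g ∅ ≠ 0`) shows the kernel on every nonempty trace. [this work] -/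
theorem eq_four_of_marked (hm : g ∅ ≠ 0) {σ : Finset α} (hσ : σ ⊆ S₀) (hne : σ.Nonempty) : g σ = 4 := by
  have h3 := h.free
  rcases h.lift hσ hne with e | e
  · rcases h.mono (empty_subset σ) hσ with m | m | m
    · rw [e] at m; exact absurd m h3
    · exact absurd m hm
    · exact m
  · exact e

omit [DecidableEq α] in
/-- Kernel traces are up-closed. [this work] -/
theorem eq_four_of_subset {σ τ : Finset α} (hστ : σ ⊆ τ) (hτ : τ ⊆ S₀) (h4 : g σ = 4) : g τ = 4 := by
  rcases h.mono hστ hτ with m | m | m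
  · rw [← m]; exact h4
  · rw [h4] at m; exact absurd m (by decide)
  · exact m

omit [DecidableEq α] in
/-- Petal traces are down-closed among nonempty traces. [this work] -/
theorem eq_three_of_subset {σ τ : Finset α} (hστ : σ ⊆ τ) (hτ : τ ⊆ S₀) (hne : σ.Nonempty) (h3 : g τ = 3) : g σ = 3 := by
  rcases h.lift (hστ.trans hτ) hne with e | e
  · exact e
  · have := h.eq_four_of_subset hστ hτ e
    rw [h3] at this; exact absurd this (by decide)

omit [DecidableEq α] in
/-- The free label is one of `0,1,2,4`. [this work] -/
theorem free_cases : g ∅ = 0 ∨ g ∅ = 1 ∨ g ∅ = 2 ∨ g ∅ = 4 := by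
  have h3 := h.free
  revert h3; generalize g ∅ = x; revert x; decide

end IsCode

/-- The row weight of a first block with code `g`: `1` if the block is marked, or bottom with `S₀` its only kernel trace. [this work] -/
def rowT (S₀ : Finset α) (g : Finset α → Fin 5) : ℤ :=
  if g ∅ ≠ 0 ∨ (g S₀ = 4 ∧ ∀ σ ∈ propers S₀, g σ = 3) then 1 else 0

/-- `rowT ∈ {0,1}` hence nonnegative. [this work] -/
theorem rowT_nonneg (S₀ : Finset α) (g : Finset α → Fin 5) : 0 ≤ rowT S₀ g := by
  unfold rowT; split_ifs <;> norm_num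

/-- The symmetrised placement sum of three block codes: `Σ_{(σ₁,σ₂,σ₃) ⊢ S₀} club6 (g₁ σ₁) (g₂ σ₂) (g₃ σ₃)`. [this work] -/
def codeSum (S₀ : Finset α) (g₁ g₂ g₃ : Finset α → Fin 5) : ℤ :=
  ∑ s ∈ partsOf S₀, club6 (g₁ s.1) (g₂ s.2) (g₃ (S₀ \ (s.1 ∪ s.2)))

/-- The three spectator-row terms of a code triple (half the symmetrised row kernel). [this work] -/
def codeRows (S₀ : Finset α) (g₁ g₂ g₃ : Finset α → Fin 5) : ℤ :=
  rowT S₀ g₁ * kk (g₂ ∅) (g₃ ∅) + rowT S₀ g₂ * kk (g₁ ∅) (g₃ ∅) + rowT S₀ g₃ * kk (g₁ ∅) (g₂ ∅)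

/-- The two-block placements of the complementary pair `{σ, S₀∖σ}` (six placements). [this work] -/
def pairSum (S₀ : Finset α) (g₁ g₂ g₃ : Finset α → Fin 5) (σ : Finset α) : ℤ :=
  (club6 (g₁ σ) (g₂ (S₀ \ σ)) (g₃ ∅) + club6 (g₁ σ) (g₂ ∅) (g₃ (S₀ \ σ)) + club6 (g₁ ∅) (g₂ σ) (g₃ (S₀ \ σ)))
    + (club6 (g₁ (S₀ \ σ)) (g₂ σ) (g₃ ∅) + club6 (g₁ (S₀ \ σ)) (g₂ ∅) (g₃ σ) + club6 (g₁ ∅) (g₂ (S₀ \ σ)) (g₃ σ))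

/-- The one-block placements together with the rows. [this work] -/
def oneSum (S₀ : Finset α) (g₁ g₂ g₃ : Finset α → Fin 5) : ℤ :=
  club6 (g₁ S₀) (g₂ ∅) (g₃ ∅) + club6 (g₁ ∅) (g₂ S₀) (g₃ ∅) + club6 (g₁ ∅) (g₂ ∅) (g₃ S₀) - 2 * codeRows S₀ g₁ g₂ g₃

/-- The three-block placements as an iterated sum. [this work] -/
def threeSum (S₀ : Finset α) (g₁ g₂ g₃ : Finset α → Fin 5) : ℤ :=
  ∑ X ∈ propers S₀, ∑ Y ∈ propers (S₀ \ X), club6 (g₁ X) (g₂ Y) (g₃ (S₀ \ (X ∪ Y)))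

/-- **Decomposition**: `2·(codeSum − 2·codeRows) = 2·oneSum + Σ_σ pairSum σ + 2·threeSum`. [this work] -/
theorem two_mul_codeSum_sub {S₀ : Finset α} (h₀ : S₀.Nonempty) (g₁ g₂ g₃ : Finset α → Fin 5) :
    2 * (codeSum S₀ g₁ g₂ g₃ - 2 * codeRows S₀ g₁ g₂ g₃)
      = 2 * oneSum S₀ g₁ g₂ g₃ + ∑ σ ∈ propers S₀, pairSum S₀ g₁ g₂ g₃ σ + 2 * threeSum S₀ g₁ g₂ g₃ := by
  unfold codeSum oneSum threeSum
  rw [sum_partsOf_decomp h₀ (fun X Y Z => club6 (g₁ X) (g₂ Y) (g₃ Z))]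
  have hp : ∑ σ ∈ propers S₀, pairSum S₀ g₁ g₂ g₃ σ
      = 2 * ∑ σ ∈ propers S₀, (club6 (g₁ σ) (g₂ (S₀ \ σ)) (g₃ ∅) + club6 (g₁ σ) (g₂ ∅) (g₃ (S₀ \ σ))
          + club6 (g₁ ∅) (g₂ σ) (g₃ (S₀ \ σ))) := by
    unfold pairSum
    rw [sum_add_distrib, ← sum_propers_sdiff S₀ (fun σ => club6 (g₁ (S₀ \ σ)) (g₂ σ) (g₃ ∅)
      + club6 (g₁ (S₀ \ σ)) (g₂ ∅) (g₃ σ) + club6 (g₁ ∅) (g₂ (S₀ \ σ)) (g₃ σ))]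
    rw [two_mul]
    congr 1
    refine sum_congr rfl fun σ hσ => ?_
    rw [Finset.sdiff_sdiff_eq_self (mem_propers.1 hσ).1]
  rw [hp]
  ring

/-! ## Finite state tables and the pointwise facts (all by `decide`) -/

/-- `club6` is nonnegative on lifted labels. [this work] -/
theorem club6_nonneg_of_ge3 : ∀ x y z : Fin 5, (x = 3 ∨ x = 4) → (y = 3 ∨ y = 4) → (z = 3 ∨ z = 4) → 0 ≤ club6 x y z := by
  decide

/-- `club6 ≥ 4` on lifted labels with at least two petal labels. [this work] -/
theorem club6_ge_four : ∀ x y z : Fin 5, (x = 3 ∨ x = 4) → (y = 3 ∨ y = 4) → (z = 3 ∨ z = 4) →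
    ((x = 3 ∧ y = 3) ∨ (x = 3 ∧ z = 3) ∨ (y = 3 ∧ z = 3)) → 4 ≤ club6 x y z := by
  decide

/-- `club6` is invariant under swapping its first two arguments. [this work] -/
theorem club6_swap12 : ∀ x y z : Fin 5, club6 x y z = club6 y x z := by decide

/-- `club6` is invariant under swapping its last two arguments. [this work] -/
theorem club6_swap23 : ∀ x y z : Fin 5, club6 x y z = club6 x z y := by decide

/-! ### One-block placements: states `(free label, label of S₀, row weight)` -/

/-- Free label of a one-block state: marked `1,2,4`; bottom with `S₀` the only kernel trace; bottom with a proper kernel trace;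
bottom with no kernel trace. [this work] -/
def osL : Fin 6 → Fin 5 := ![1, 2, 4, 0, 0, 0]

/-- Label of the full trace `S₀` of a one-block state. [this work] -/
def osTop : Fin 6 → Fin 5 := ![4, 4, 4, 4, 4, 3]

/-- Row weight of a one-block state. [this work] -/
def osT : Fin 6 → ℤ := ![1, 1, 1, 1, 0, 0]

/-- The one-block placements with rows, on states. [this work] -/
def oneOf (s₁ s₂ s₃ : Fin 6) : ℤ :=
  club6 (osTop s₁) (osL s₂) (osL s₃) + club6 (osL s₁) (osTop s₂) (osL s₃) + club6 (osL s₁) (osL s₂) (osTop s₃)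
    - 2 * (osT s₁ * kk (osL s₂) (osL s₃) + osT s₂ * kk (osL s₁) (osL s₃) + osT s₃ * kk (osL s₁) (osL s₂))

/-- `oneOf ≥ −2`. [this work] -/
theorem oneOf_ge : ∀ s₁ s₂ s₃ : Fin 6, -2 ≤ oneOf s₁ s₂ s₃ := by decide

/-- A negative `oneOf` pins the configuration: two marked blocks and a bottom block with a proper kernel trace (state `4`). [this work] -/
theorem oneOf_neg_cases : ∀ s₁ s₂ s₃ : Fin 6, oneOf s₁ s₂ s₃ < 0 →
    (s₁ = 4 ∧ s₂.val < 3 ∧ s₃.val < 3) ∨ (s₂ = 4 ∧ s₁.val < 3 ∧ s₃.val < 3) ∨ (s₃ = 4 ∧ s₁.val < 3 ∧ s₂.val < 3) := by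
  decide

/-- Three bottom blocks: `oneOf = 4 · #{i : S₀ is a kernel trace of block i}` is nonnegative, and `= 12` when all are. [this work] -/
theorem oneOf_bottom : ∀ s₁ s₂ s₃ : Fin 6, 3 ≤ s₁.val → 3 ≤ s₂.val → 3 ≤ s₃.val →
    0 ≤ oneOf s₁ s₂ s₃ ∧ (osTop s₁ = 4 → osTop s₂ = 4 → osTop s₃ = 4 → oneOf s₁ s₂ s₃ = 12) := by
  decide

/-! ### Two-block placements: states `(free label, label of σ, label of S₀ ∖ σ)` -/

/-- Free label of a pair state. [this work] -/
def psL : Fin 7 → Fin 5 := ![1, 2, 4, 0, 0, 0, 0]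

/-- Label of the trace `σ` of a pair state. [this work] -/
def psA : Fin 7 → Fin 5 := ![4, 4, 4, 3, 3, 4, 4]

/-- Label of the trace `S₀ ∖ σ` of a pair state. [this work] -/
def psB : Fin 7 → Fin 5 := ![4, 4, 4, 3, 4, 3, 4]

/-- The six two-block placements of a complementary pair, on states. [this work] -/
def pairOf (s₁ s₂ s₃ : Fin 7) : ℤ :=
  (club6 (psA s₁) (psB s₂) (psL s₃) + club6 (psA s₁) (psL s₂) (psB s₃) + club6 (psL s₁) (psA s₂) (psB s₃))
    + (club6 (psB s₁) (psA s₂) (psL s₃) + club6 (psB s₁) (psL s₂) (psA s₃) + club6 (psL s₁) (psB s₂) (psA s₃))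

/-- With at least one marked block, `pairOf ≥ 0`. [this work] -/
theorem pairOf_nonneg_marked : ∀ s₁ s₂ s₃ : Fin 7, (s₁.val < 3 ∨ s₂.val < 3 ∨ s₃.val < 3) → 0 ≤ pairOf s₁ s₂ s₃ := by
  decide

/-- Two marked blocks and a kernel trace on the bottom third block give `pairOf ≥ 4`. [this work] -/
theorem pairOf_ge_four : ∀ s₁ s₂ s₃ : Fin 7, s₁.val < 3 → s₂.val < 3 → 3 ≤ s₃.val → (psA s₃ = 4 ∨ psB s₃ = 4) →
    4 ≤ pairOf s₁ s₂ s₃ := by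
  decide

/-- Three bottom blocks: `pairOf ≥ −12` exactly on the uniformly oriented pairs, else `≥ 0`. [this work] -/
theorem pairOf_bottom : ∀ s₁ s₂ s₃ : Fin 7, 3 ≤ s₁.val → 3 ≤ s₂.val → 3 ≤ s₃.val →
    -12 * ((if psA s₁ = 3 ∧ psA s₂ = 3 ∧ psA s₃ = 3 ∧ psB s₁ = 4 ∧ psB s₂ = 4 ∧ psB s₃ = 4 then (1 : ℤ) else 0)
      + (if psB s₁ = 3 ∧ psB s₂ = 3 ∧ psB s₃ = 3 ∧ psA s₁ = 4 ∧ psA s₂ = 4 ∧ psA s₃ = 4 then (1 : ℤ) else 0))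
      ≤ pairOf s₁ s₂ s₃ := by
  decide

/-! ### Realising states -/

/-- Every admissible pair datum is a pair state. [this work] -/
theorem exists_pairState : ∀ l a b : Fin 5, l ≠ 3 → (a = 3 ∨ a = 4) → (b = 3 ∨ b = 4) → (l ≠ 0 → a = 4) → (l ≠ 0 → b = 4) →
    ∃ s : Fin 7, psL s = l ∧ psA s = a ∧ psB s = b := by
  decide

/-- Every admissible one-block datum is a one-block state. [this work] -/
theorem exists_oneState : ∀ l L : Fin 5, ∀ T : Bool, l ≠ 3 → (L = 3 ∨ L = 4) → (l ≠ 0 → L = 4) → (l ≠ 0 → T = true) →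
    (L = 3 → T = false) →
    ∃ s : Fin 6, osL s = l ∧ osTop s = L ∧ osT s = (if T then 1 else 0) := by
  decide

/-! ## States and blocks: small facts -/

/-- Marked one-block states are exactly those with nonzero free label. [this work] -/
theorem osL_ne_zero_iff : ∀ s : Fin 6, s.val < 3 ↔ osL s ≠ 0 := by decide

/-- Marked pair states are exactly those with nonzero free label. [this work] -/
theorem psL_ne_zero_iff : ∀ s : Fin 7, s.val < 3 ↔ psL s ≠ 0 := by decide

/-- The blocks of a three-block placement indexed by `X ∈ propers S₀`, `Y ∈ propers (S₀ ∖ X)`. [this work] -/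
theorem three_blocks {S₀ X Y : Finset α} (hX : X ∈ propers S₀) (hY : Y ∈ propers (S₀ \ X)) :
    X ⊆ S₀ ∧ X.Nonempty ∧ Y ⊆ S₀ ∧ Y.Nonempty ∧ Disjoint X Y ∧ S₀ \ (X ∪ Y) ⊆ S₀ ∧ (S₀ \ (X ∪ Y)).Nonempty := by
  obtain ⟨hX1, hX2, _⟩ := mem_propers.1 hX
  obtain ⟨hY1, hY2, hY3⟩ := mem_propers.1 hY
  refine ⟨hX1, nonempty_iff_ne_empty.2 hX2, hY1.trans sdiff_subset, nonempty_iff_ne_empty.2 hY2,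
    (disjoint_sdiff.mono_right hY1), sdiff_subset, ?_⟩
  rw [nonempty_iff_ne_empty]
  intro he
  apply hY3
  refine Subset.antisymm hY1 fun x hx => ?_
  have hx' := mem_sdiff.1 hx
  by_contra hxY
  have : x ∈ S₀ \ (X ∪ Y) := mem_sdiff.2 ⟨hx'.1, fun hh => (mem_union.1 hh).elim hx'.2 hxY⟩
  rw [he] at this
  exact notMem_empty x this

end Summit.CriticalPhenomena.PercolationContinuityZ3.Theorems.SunflowerPartition
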